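import Mathlib.Probability.Distributions.Gaussian.HasGaussianLaw.Independence
import Mathlib.Probability.Distributions.Gaussian.Multivariate
import Mathlib.Probability.Independence.Integration
import HarnessLib

/-!
# Finite-range Gaussian fields: functionals of uncorrelated regions factorise

For a Gaussian vector `ζ ∼ N(μ₀, S)` on `ℝ^ι` (Mathlib's
`ProbabilityTheory.multivariateGaussian μ₀ S`, `S ⪰ 0` possibly singular) and two index sets `I, J`
with vanishing cross-covariances, `S i j = 0` for `i ∈ I`, `j ∈ J`, the restricted fields
`ζ|_I`, `ζ|_J` are jointly Gaussian and uncorrelated, hence **independent**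
(`indepFun_restrict_multivariateGaussian`, from Mathlib's
`HasGaussianLaw.indepFun_of_covariance_eval`), and for measurable functionals `F, G` of the field
depending only on the coordinates in `I`, resp. `J`,

  `∫ F·G dN(μ₀,S) = (∫ F dN(μ₀,S)) · (∫ G dN(μ₀,S))`   (`integral_mul_eq_of_dependsOn_of_cross_eq_zero`).

This is the mechanism of a FINITE-RANGE covariance decomposition in a renormalisation-group step:
if the fluctuation covariance `C_j` has range `< dist(X, Y)`, the fluctuation integrals of polymer
activities supported on `X` and on `Y` factorise exactly,
`𝔼_{C_j}[K(X) K(Y)] = 𝔼_{C_j}[K(X)] 𝔼_{C_j}[K(Y)]` (Brydges–Guadagni–Mitter 2004;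
Bauerschmidt–Brydges–Slade 2019, Ch. 4: the finite-range property makes the fluctuation fields on
non-adjacent blocks independent).

## References

* R. Bauerschmidt, D. C. Brydges, G. Slade, *Introduction to a Renormalisation Group Method*,
  LNM 2242 (2019), Ch. 4 (finite-range decomposition and independence). [BauerschmidtBrydgesSlade2019RG]
* D. C. Brydges, G. Guadagni, P. K. Mitter, *Finite range decomposition of Gaussian processes*,
  J. Stat. Phys. 115 (2004) 415–449. [BrydgesGuadagniMitter2004]
-/

noncomputable section

namespace Literature.Probability.Distributions

open MeasureTheory ProbabilityTheory Matrix WithLp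

variable {ι : Type*} [Fintype ι] [DecidableEq ι] {S : Matrix ι ι ℝ}

/-- The restriction of the field to an index set `I`, as a continuous linear map
`ℝ^ι → (I → ℝ)`. [folklore] -/
def restrictCLM (I : Finset ι) : EuclideanSpace ℝ ι →L[ℝ] (↥I → ℝ) :=
  ContinuousLinearMap.pi fun i : ↥I => (EuclideanSpace.proj (i : ι) : EuclideanSpace ℝ ι →L[ℝ] ℝ)

omit [Fintype ι] [DecidableEq ι] in
/-- `restrictCLM I x i = x i`. [folklore] -/
@[simp] theorem restrictCLM_apply (I : Finset ι) (x : EuclideanSpace ℝ ι) (i : ↥I) :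
    restrictCLM I x i = x (i : ι) := rfl

/-- The pair of restrictions `(ζ|_I, ζ|_J)` of a Gaussian vector is Gaussian. [folklore] -/
theorem hasGaussianLaw_restrict_pair (μ₀ : EuclideanSpace ℝ ι) (S : Matrix ι ι ℝ) (I J : Finset ι) :
    HasGaussianLaw (fun x : EuclideanSpace ℝ ι =>
      (fun i : ↥I => x (i : ι), fun j : ↥J => x (j : ι))) (multivariateGaussian μ₀ S) :=
  (IsGaussian.hasGaussianLaw_id (μ := multivariateGaussian μ₀ S)).map ((restrictCLM I).prod (restrictCLM J))

/-- **Uncorrelated restrictions of a Gaussian vector are independent**: if `S i j = 0` for all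
`i ∈ I`, `j ∈ J`, then `ζ|_I` and `ζ|_J` are independent under `N(μ₀, S)`.
[cite: BauerschmidtBrydgesSlade2019RG, Ch. 4] -/
theorem indepFun_restrict_multivariateGaussian (μ₀ : EuclideanSpace ℝ ι) (hS : S.PosSemidef)
    {I J : Finset ι} (hIJ : ∀ i ∈ I, ∀ j ∈ J, S i j = 0) :
    IndepFun (fun (x : EuclideanSpace ℝ ι) (i : ↥I) => x (i : ι))
      (fun (x : EuclideanSpace ℝ ι) (j : ↥J) => x (j : ι)) (multivariateGaussian μ₀ S) := by
  refine HasGaussianLaw.indepFun_of_covariance_eval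
    (X := fun (i : ↥I) (x : EuclideanSpace ℝ ι) => x (i : ι))
    (Y := fun (j : ↥J) (x : EuclideanSpace ℝ ι) => x (j : ι)) (hasGaussianLaw_restrict_pair μ₀ S I J) ?_
  intro i j
  rw [covariance_eval_multivariateGaussian hS]
  exact hIJ i i.2 j j.2

/-! ### Factorisation of expectations -/

variable {𝕜 : Type*} [RCLike 𝕜]

/-- **Factorisation for functions of the restricted fields**: for measurable `f : (I → ℝ) → 𝕜`,
`g : (J → ℝ) → 𝕜` and uncorrelated `I, J`,
`∫ f(ζ|_I) g(ζ|_J) dN = (∫ f(ζ|_I) dN)(∫ g(ζ|_J) dN)`. [cite: BauerschmidtBrydgesSlade2019RG, Ch. 4] -/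
theorem integral_comp_restrict_mul_eq (μ₀ : EuclideanSpace ℝ ι) (hS : S.PosSemidef) {I J : Finset ι}
    (hIJ : ∀ i ∈ I, ∀ j ∈ J, S i j = 0) {f : (↥I → ℝ) → 𝕜} {g : (↥J → ℝ) → 𝕜}
    (hf : Measurable f) (hg : Measurable g) :
    ∫ x, f (fun i : ↥I => x (i : ι)) * g (fun j : ↥J => x (j : ι)) ∂(multivariateGaussian μ₀ S) =
      (∫ x, f (fun i : ↥I => x (i : ι)) ∂(multivariateGaussian μ₀ S)) *
        ∫ x, g (fun j : ↥J => x (j : ι)) ∂(multivariateGaussian μ₀ S) := by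
  have hind := (indepFun_restrict_multivariateGaussian μ₀ hS hIJ).comp hf hg
  have hmI : Measurable fun (x : EuclideanSpace ℝ ι) (i : ↥I) => x (i : ι) := by fun_prop
  have hmJ : Measurable fun (x : EuclideanSpace ℝ ι) (j : ↥J) => x (j : ι) := by fun_prop
  exact hind.integral_fun_mul_eq_mul_integral (hf.comp hmI).aestronglyMeasurable (hg.comp hmJ).aestronglyMeasurable

/-- Extension by zero of a configuration on `I` to the whole field. [folklore] -/
def extendByZero (I : Finset ι) (u : ↥I → ℝ) : EuclideanSpace ℝ ι :=
  toLp 2 fun i => if h : i ∈ I then u ⟨i, h⟩ else 0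

omit [Fintype ι] in
/-- `extendByZero` agrees with `u` on `I`. [folklore] -/
theorem extendByZero_apply_of_mem (I : Finset ι) (u : ↥I → ℝ) (i : ↥I) :
    extendByZero I u (i : ι) = u i := by
  have hi : (i : ι) ∈ I := i.2
  simp [extendByZero, hi]

omit [Fintype ι] in
/-- `extendByZero` is measurable. [folklore] -/
theorem measurable_extendByZero (I : Finset ι) : Measurable (extendByZero (ι := ι) I) := by
  unfold extendByZero
  refine (WithLp.measurable_toLp 2 _).comp ?_
  refine measurable_pi_lambda _ fun i => ?_
  by_cases h : i ∈ I
  · simp only [h, ↓reduceDIte]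
    exact measurable_pi_apply _
  · simp only [h, ↓reduceDIte]
    exact measurable_const

omit [Fintype ι] in
/-- A functional depending only on the coordinates in `I` factors through the restriction to `I`.
[folklore] -/
theorem eq_apply_extendByZero_of_dependsOn {β : Type*} {F : EuclideanSpace ℝ ι → β} {I : Finset ι}
    (hF : ∀ x y : EuclideanSpace ℝ ι, (∀ i ∈ I, x i = y i) → F x = F y) (x : EuclideanSpace ℝ ι) :
    F x = F (extendByZero I (fun i : ↥I => x (i : ι))) :=
  hF x _ fun i hi => by rw [extendByZero_apply_of_mem I _ ⟨i, hi⟩]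

/-- **Functionals of uncorrelated regions factorise.** Let `S ⪰ 0` with `S i j = 0` for `i ∈ I`,
`j ∈ J`, and let `F, G : ℝ^ι → 𝕜` be measurable with `F` depending only on the coordinates in `I`
and `G` only on those in `J`. Then under `ζ ∼ N(μ₀, S)`,
`𝔼[F(ζ) G(ζ)] = 𝔼[F(ζ)] 𝔼[G(ζ)]` — e.g. fluctuation integrals over a finite-range covariance of
polymer activities on polymers farther apart than the range. [cite: BauerschmidtBrydgesSlade2019RG, Ch. 4] -/
theorem integral_mul_eq_of_dependsOn_of_cross_eq_zero (μ₀ : EuclideanSpace ℝ ι) (hS : S.PosSemidef)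
    {I J : Finset ι} (hIJ : ∀ i ∈ I, ∀ j ∈ J, S i j = 0) {F G : EuclideanSpace ℝ ι → 𝕜}
    (hFm : Measurable F) (hGm : Measurable G)
    (hF : ∀ x y : EuclideanSpace ℝ ι, (∀ i ∈ I, x i = y i) → F x = F y)
    (hG : ∀ x y : EuclideanSpace ℝ ι, (∀ j ∈ J, x j = y j) → G x = G y) :
    ∫ x, F x * G x ∂(multivariateGaussian μ₀ S) =
      (∫ x, F x ∂(multivariateGaussian μ₀ S)) * ∫ x, G x ∂(multivariateGaussian μ₀ S) := by
  set f : (↥I → ℝ) → 𝕜 := fun u => F (extendByZero I u) with hf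
  set g : (↥J → ℝ) → 𝕜 := fun u => G (extendByZero J u) with hg
  have hfm : Measurable f := hFm.comp (measurable_extendByZero I)
  have hgm : Measurable g := hGm.comp (measurable_extendByZero J)
  have hFf : ∀ x, F x = f (fun i : ↥I => x (i : ι)) := fun x => eq_apply_extendByZero_of_dependsOn hF x
  have hGg : ∀ x, G x = g (fun j : ↥J => x (j : ι)) := fun x => eq_apply_extendByZero_of_dependsOn hG x
  simp_rw [hFf, hGg]
  exact integral_comp_restrict_mul_eq μ₀ hS hIJ hfm hgm

end Literature.Probability.Distributions

end
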